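import Literature.RepresentationTheory.Kovacevic2021.SU21CohomologyDegreeOne
import Literature.RepresentationTheory.Kovacevic2021.SU21RelativeCochainsDegreeTwoEquiv
import Literature.RepresentationTheory.Kovacevic2021.SU21RelativeCochainsDegreeThreeEquiv
import Literature.RepresentationTheory.Kovacevic2021.SU21RelativeCochainsDegreeFourEquiv
import Literature.RepresentationTheory.Kovacevic2021.SU21RelativeCochainsDegreeFive
import HarnessLib

/-!
# Kovačević's `SU(2,1)`-modules: `H²`, `H³`, `H⁴`, `H⁵(𝔤, 𝔨; V)` for the six cohomological modules —
# Borel–Wallach VI 4.11 at `n = 2` in degrees `2`–`5`, on the tree's Chevalley–Eilenberg carriers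

Topic `RepresentationTheory/Kovacevic2021`; namespace `Literature.RepresentationTheory.Kovacevic2021`.
Theorems only; no named fact.  Inputs: `C¹ ≅ hw(2,3) × hw(2,-3)` (`SU21RelativeCochainsDegreeOne`),
`C² ≅ hw(1,6) × hw(3,0) × hw(1,0) × hw(1,-6)` (`SU21RelativeCochainsDegreeTwoEquiv`), `C³ ≅ hw(2,3) × hw(2,-3)`
(`SU21RelativeCochainsDegreeThreeEquiv`), `C⁴ ≃ hw(1,0)` (`…DegreeFourEquiv`), `C³ = 0` unless `(2,±3) ∈ S`,
`C⁴ = 0` unless `(1,0) ∈ S` (`…DegreeThree/Four`) and `C⁵ = 0` (`…DegreeFive`), and the degree-local form of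
[BorelWallach2000, II Prop. 3.1 (b)] (`SU21CohomologyDegreeOne`): if `C^{q-1} = 0` and `C^{q+1} = 0` then
`H^q = C^q` (`finrank_relCohomology_succ_eq`), and `H^q = 0` if `C^q = 0` (`finrank_relCohomology_eq_zero`).

Borel–Wallach [BorelWallach2000, VI Thm 4.11 (2), (3) with 4.10 (3), `n = 2`]: `H²(D_i) = ℂ` (`i = 0,1,2`,
of Hodge types `(0,2), (1,1), (2,0)`), `H²(J_{0,0}) = ℂ` (the class `L`), `H²(J_{1,0}) = H²(J_{0,1}) = 0`;
`H³ ≠ 0` only for `J_{1,0}, J_{0,1}`; `H⁴ ≠ 0` only for `J_{0,0}`.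

## What is proved (the six constructed modules of `SU21ModulesFromKTypes`)

* `six_Ktypes₂`: which of `V_{1,6}, V_{3,0}, V_{1,0}, V_{1,-6}` occur in each of the six modules;
* **`dim H²(𝔤, 𝔨; V) = 1` for `U(0) = J_{0,0}`, `D₂`, `D₀`, `D₁`** (`finrank_relCohomology_two_trivialMod/holDS/
  antiholDS/midDS`: `C¹ = C³ = 0` and `dim C² = 1`, the unique `K`-type being `V_{1,0}` (class `L`), `V_{1,6} = Λ²𝔭⁺`
  (type `(2,0)`), `V_{1,-6} = Λ²𝔭⁻` (type `(0,2)`), `V_{3,0} = F_{1,1}` (type `(1,1)`) respectively);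
  **`H² = 0` for `J_{1,0}`, `J_{0,1}`** (`finrank_relCohomology_two_ladderPlus/Minus`: `C² = 0`);
* **`dim H³(𝔤, 𝔨; J_{1,0}) = dim H³(𝔤, 𝔨; J_{0,1}) = 1`** (`finrank_relCohomology_three_ladderPlus/Minus`: `C² = C⁴ = 0`,
  `dim C³ = 1`), `H³ = 0` for `U(0)`, `D₂`, `D₀`, `D₁` and `H⁴ = 0` for `D₂`, `D₀`, `D₁`, `J_{1,0}`, `J_{0,1}`
  (`finrank_relCohomology_three_eq_zero_four`, `finrank_relCohomology_four_eq_zero_five`).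

* **`dim H⁴(𝔤, 𝔨; U(0)) = 1`** (`finrank_relCohomology_four_trivialMod`: `C³ = C⁵ = 0`, `dim C⁴ = [(1,0) ∈ S] = 1`) and
  `H⁵ = 0` for all six (`finrank_relCohomology_five_eq_zero`; `C⁵ = 0`).
This completes Borel–Wallach's table VI Thm 4.11 (2), (3) at `n = 2` in degrees `0 ≤ q ≤ 5` for the six constructed
modules (degrees `q ≥ 6` would need `C^q = 0`, the same pigeonhole argument at higher arity).

## References

* A. Borel, N. Wallach (2000), II Prop. 3.1 p. 36; VI 4.8–4.11 pp. 130–133 (held chunks p0062, p0165–p0169).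
  [BorelWallach2000]
* D. Kovačević, Acta Math. Spalatensia 1 (2021) 105–125, §4. [Kovacevic2021]
* D. A. Vogan, G. J. Zuckerman, Compositio Math. 53 (1984) 51–90. [VoganZuckerman1984]
-/

noncomputable section

open Finsupp Module
open Literature.Algebra.Lie Literature.Algebra.Lie.ChevalleyEilenberg

namespace Literature.RepresentationTheory.Kovacevic2021

-- Mathlib idiom (Mathlib/Algebra/Lie/OfAssociative.lean): bracket on `Matrix`/`Module.End` = commutator.
attribute [local instance 100] LieRing.ofAssociativeRing

namespace SU21Datum

variable (𝒟 : SU21Datum)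

/-! ### `H^q` from the vanishing of the neighbouring cochain spaces (any datum) -/

/-- `H^q(𝔤, 𝔨; V) = 0` if `C^q(𝔤, 𝔨; V) = 0`. [cite: BorelWallach2000, I §1.2 (1)] -/
theorem finrank_relCohomology_eq_zero (q : ℕ) (h : 𝒟.relCochain q = ⊥) :
    finrank ℂ (relCohomology ℂ gl3 𝒟.V kSub q) = 0 := by
  haveI : Subsingleton ((Subcomplex.rel ℂ gl3 𝒟.V kSub).cocycles q) := by
    refine ⟨fun a b => Subtype.ext ?_⟩
    have ha : (a : Cochain ℂ gl3 𝒟.V q) ∈ 𝒟.relCochain q := ((Subcomplex.mem_cocycles_iff _ q _).1 a.2).1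
    have hb : (b : Cochain ℂ gl3 𝒟.V q) ∈ 𝒟.relCochain q := ((Subcomplex.mem_cocycles_iff _ q _).1 b.2).1
    rw [h, Submodule.mem_bot] at ha hb
    rw [ha, hb]
  haveI : Subsingleton (relCohomology ℂ gl3 𝒟.V kSub q) :=
    ((Subcomplex.rel ℂ gl3 𝒟.V kSub).toCohomology_surjective q).subsingleton
  exact Module.finrank_zero_of_subsingleton

/-- **If `C^q = 0` and `C^{q+2} = 0` then `dim H^{q+1}(𝔤, 𝔨; V) = dim C^{q+1}(𝔤, 𝔨; V)`** (no coboundaries; every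
`(q+1)`-cochain is closed because its differential is a relative `(q+2)`-cochain).
[cite: BorelWallach2000, II Prop. 3.1 (b)] -/
theorem finrank_relCohomology_succ_eq (q : ℕ) (hprev : 𝒟.relCochain q = ⊥) (hnext : 𝒟.relCochain (q + 1 + 1) = ⊥) :
    finrank ℂ (relCohomology ℂ gl3 𝒟.V kSub (q + 1)) = finrank ℂ (𝒟.relCochain (q + 1)) :=
  finrank_cohomology_succ_of_closed (Subcomplex.rel ℂ gl3 𝒟.V kSub) q
    (fun g hg => by
      have hg' : g ∈ 𝒟.relCochain q := hg
      rw [hprev, Submodule.mem_bot] at hg'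
      rw [hg', map_zero])
    (fun f hf => by
      have hd : d ℂ gl3 𝒟.V (q + 1) f ∈ 𝒟.relCochain (q + 1 + 1) :=
        (Subcomplex.rel ℂ gl3 𝒟.V kSub).d_mem (q + 1) f hf
      rwa [hnext, Submodule.mem_bot] at hd)

/-! ### The six cohomological modules -/

section Six

/-- `K`-type bookkeeping in degree `2`: which of `V_{1,6}`, `V_{3,0}`, `V_{1,0}`, `V_{1,-6}` occur.
[cite: Kovacevic2021, §4] [cite: BorelWallach2000, VI 4.10 (3), Thm 4.11 (9)] -/
theorem six_Ktypes₂ :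
    (((1 : ℤ), (6 : ℤ)) ∉ trivialMod.S ∧ ((3 : ℤ), (0 : ℤ)) ∉ trivialMod.S ∧ ((1 : ℤ), (-6 : ℤ)) ∉ trivialMod.S) ∧
    (((1 : ℤ), (6 : ℤ)) ∈ holDS.S ∧ ((3 : ℤ), (0 : ℤ)) ∉ holDS.S ∧ ((1 : ℤ), (-6 : ℤ)) ∉ holDS.S) ∧
    (((1 : ℤ), (6 : ℤ)) ∉ antiholDS.S ∧ ((3 : ℤ), (0 : ℤ)) ∉ antiholDS.S ∧ ((1 : ℤ), (-6 : ℤ)) ∈ antiholDS.S) ∧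
    (((1 : ℤ), (6 : ℤ)) ∉ midDS.S ∧ ((3 : ℤ), (0 : ℤ)) ∈ midDS.S ∧ ((1 : ℤ), (-6 : ℤ)) ∉ midDS.S) ∧
    (((1 : ℤ), (6 : ℤ)) ∉ ladderPlus.S ∧ ((3 : ℤ), (0 : ℤ)) ∉ ladderPlus.S ∧ ((1 : ℤ), (-6 : ℤ)) ∉ ladderPlus.S) ∧
    (((1 : ℤ), (6 : ℤ)) ∉ ladderMinus.S ∧ ((3 : ℤ), (0 : ℤ)) ∉ ladderMinus.S ∧ ((1 : ℤ), (-6 : ℤ)) ∉ ladderMinus.S) := by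
  refine ⟨⟨?_, ?_, ?_⟩, ?_, ?_, ?_, ?_, ?_⟩
  · simp [trivialMod]
  · simp [trivialMod]
  · simp [trivialMod]
  · simp only [mem_holDS]; omega
  · simp only [mem_antiholDS]; omega
  · refine ⟨?_, ⟨0, 0, by norm_num, by norm_num⟩, ?_⟩ <;> simp only [mem_midDS] <;> omega
  · simp only [mem_ladderPlus]; omega
  · simp only [mem_ladderMinus]; omega

/-- `C³ = 0` for the four modules without `V_{2,±3}`: `U(0)`, `D₂`, `D₀`, `D₁`. [cite: BorelWallach2000, VI Thm 4.11 (11)] -/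
theorem relCochain_three_eq_bot_four :
    trivialMod.relCochain 3 = ⊥ ∧ holDS.relCochain 3 = ⊥ ∧ antiholDS.relCochain 3 = ⊥ ∧ midDS.relCochain 3 = ⊥ :=
  ⟨trivialMod.relCochain_three_eq_bot six_Ktypes.1.2.1 six_Ktypes.1.2.2,
    holDS.relCochain_three_eq_bot six_Ktypes.2.1.2.1 six_Ktypes.2.1.2.2,
    antiholDS.relCochain_three_eq_bot six_Ktypes.2.2.1.2.1 six_Ktypes.2.2.1.2.2,
    midDS.relCochain_three_eq_bot six_Ktypes.2.2.2.1.2.1 six_Ktypes.2.2.2.1.2.2⟩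

/-- `C¹ = 0` for the same four modules. [cite: BorelWallach2000, VI Thm 4.11 (11)] -/
theorem relCochain_one_eq_bot_four :
    trivialMod.relCochain 1 = ⊥ ∧ holDS.relCochain 1 = ⊥ ∧ antiholDS.relCochain 1 = ⊥ ∧ midDS.relCochain 1 = ⊥ :=
  ⟨trivialMod.relCochain_one_eq_bot six_Ktypes.1.2.1 six_Ktypes.1.2.2,
    holDS.relCochain_one_eq_bot six_Ktypes.2.1.2.1 six_Ktypes.2.1.2.2,
    antiholDS.relCochain_one_eq_bot six_Ktypes.2.2.1.2.1 six_Ktypes.2.2.1.2.2,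
    midDS.relCochain_one_eq_bot six_Ktypes.2.2.2.1.2.1 six_Ktypes.2.2.2.1.2.2⟩

/-- **`dim H²(𝔤, 𝔨; U(0)) = 1`** (`J_{0,0}`: the class `L ∈ Hom_𝔨(Λ^{1,1}, ℂ)`, `H² = C² ≅ hw(1,0)`).
[cite: BorelWallach2000, VI 4.8 (4), Thm 4.11 (3)] -/
theorem finrank_relCohomology_two_trivialMod : finrank ℂ (relCohomology ℂ gl3 trivialMod.V kSub 2) = 1 := by
  rw [trivialMod.finrank_relCohomology_succ_eq 1 relCochain_one_eq_bot_four.1 relCochain_three_eq_bot_four.1,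
    finrank_relCochain_two, if_neg six_Ktypes₂.1.1, if_neg six_Ktypes₂.1.2.1, if_pos six_Ktypes.1.1,
    if_neg six_Ktypes₂.1.2.2]

/-- **`dim H²(𝔤, 𝔨; D₂) = 1`** (the holomorphic discrete series: `H² = C² ≅ hw(1,6) = Hom_𝔨(Λ²𝔭⁺, D₂)`, Hodge
type `(2,0)`). [cite: BorelWallach2000, VI 4.10 (3), Thm 4.11 (2)] -/
theorem finrank_relCohomology_two_holDS : finrank ℂ (relCohomology ℂ gl3 holDS.V kSub 2) = 1 := by
  rw [holDS.finrank_relCohomology_succ_eq 1 relCochain_one_eq_bot_four.2.1 relCochain_three_eq_bot_four.2.1,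
    finrank_relCochain_two, if_pos six_Ktypes₂.2.1.1, if_neg six_Ktypes₂.2.1.2.1, if_neg six_Ktypes.2.1.1,
    if_neg six_Ktypes₂.2.1.2.2]

/-- **`dim H²(𝔤, 𝔨; D₀) = 1`** (antiholomorphic discrete series, `Hom_𝔨(Λ²𝔭⁻, D₀)`, type `(0,2)`).
[cite: BorelWallach2000, VI 4.10 (3), Thm 4.11 (2)] -/
theorem finrank_relCohomology_two_antiholDS : finrank ℂ (relCohomology ℂ gl3 antiholDS.V kSub 2) = 1 := by
  rw [antiholDS.finrank_relCohomology_succ_eq 1 relCochain_one_eq_bot_four.2.2.1 relCochain_three_eq_bot_four.2.2.1,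
    finrank_relCochain_two, if_neg six_Ktypes₂.2.2.1.1, if_neg six_Ktypes₂.2.2.1.2.1, if_neg six_Ktypes.2.2.1.1,
    if_pos six_Ktypes₂.2.2.1.2.2]

/-- **`dim H²(𝔤, 𝔨; D₁) = 1`** (the discrete series with lowest `K`-type `F_{1,1} = V_{3,0}`, type `(1,1)`).
[cite: BorelWallach2000, VI 4.10 (3), Thm 4.11 (2)] -/
theorem finrank_relCohomology_two_midDS : finrank ℂ (relCohomology ℂ gl3 midDS.V kSub 2) = 1 := by
  rw [midDS.finrank_relCohomology_succ_eq 1 relCochain_one_eq_bot_four.2.2.2 relCochain_three_eq_bot_four.2.2.2,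
    finrank_relCochain_two, if_neg six_Ktypes₂.2.2.2.1.1, if_pos six_Ktypes₂.2.2.2.1.2.1, if_neg six_Ktypes.2.2.2.1.1,
    if_neg six_Ktypes₂.2.2.2.1.2.2]

/-- **`H²(𝔤, 𝔨; J_{1,0}) = 0`** (`C² = 0`: none of `V_{1,6}, V_{3,0}, V_{1,0}, V_{1,-6}` is a `K`-type of `Z(3)`).
[cite: BorelWallach2000, VI Thm 4.11 (3)] -/
theorem finrank_relCohomology_two_ladderPlus : finrank ℂ (relCohomology ℂ gl3 ladderPlus.V kSub 2) = 0 :=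
  ladderPlus.finrank_relCohomology_eq_zero 2
    (ladderPlus.relCochain_two_eq_bot six_Ktypes₂.2.2.2.2.1.1 six_Ktypes₂.2.2.2.2.1.2.1 six_Ktypes.2.2.2.2.1.1
      six_Ktypes₂.2.2.2.2.1.2.2)

/-- **`H²(𝔤, 𝔨; J_{0,1}) = 0`**. [cite: BorelWallach2000, VI Thm 4.11 (3)] -/
theorem finrank_relCohomology_two_ladderMinus : finrank ℂ (relCohomology ℂ gl3 ladderMinus.V kSub 2) = 0 :=
  ladderMinus.finrank_relCohomology_eq_zero 2
    (ladderMinus.relCochain_two_eq_bot six_Ktypes₂.2.2.2.2.2.1 six_Ktypes₂.2.2.2.2.2.2.1 six_Ktypes.2.2.2.2.2.1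
      six_Ktypes₂.2.2.2.2.2.2.2)

/-- **`dim H³(𝔤, 𝔨; J_{1,0}) = 1`** (Borel–Wallach: `H^q(J_{1,0}) = ℂ` for `q = 1, 3`; here `C² = C⁴ = 0` and
`dim C³ = [(2,3) ∈ S] + [(2,-3) ∈ S] = 1`). [cite: BorelWallach2000, VI Thm 4.11 (3)] -/
theorem finrank_relCohomology_three_ladderPlus : finrank ℂ (relCohomology ℂ gl3 ladderPlus.V kSub 3) = 1 := by
  rw [ladderPlus.finrank_relCohomology_succ_eq 2
      (ladderPlus.relCochain_two_eq_bot six_Ktypes₂.2.2.2.2.1.1 six_Ktypes₂.2.2.2.2.1.2.1 six_Ktypes.2.2.2.2.1.1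
        six_Ktypes₂.2.2.2.2.1.2.2)
      (ladderPlus.relCochain_four_eq_bot six_Ktypes.2.2.2.2.1.1),
    finrank_relCochain_three, if_pos six_Ktypes.2.2.2.2.1.2.1, if_neg six_Ktypes.2.2.2.2.1.2.2]

/-- **`dim H³(𝔤, 𝔨; J_{0,1}) = 1`**. [cite: BorelWallach2000, VI Thm 4.11 (3)] -/
theorem finrank_relCohomology_three_ladderMinus : finrank ℂ (relCohomology ℂ gl3 ladderMinus.V kSub 3) = 1 := by
  rw [ladderMinus.finrank_relCohomology_succ_eq 2
      (ladderMinus.relCochain_two_eq_bot six_Ktypes₂.2.2.2.2.2.1 six_Ktypes₂.2.2.2.2.2.2.1 six_Ktypes.2.2.2.2.2.1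
        six_Ktypes₂.2.2.2.2.2.2.2)
      (ladderMinus.relCochain_four_eq_bot six_Ktypes.2.2.2.2.2.1),
    finrank_relCochain_three, if_neg six_Ktypes.2.2.2.2.2.2.1, if_pos six_Ktypes.2.2.2.2.2.2.2]

/-- `H³ = 0` for `U(0)`, `D₂`, `D₀`, `D₁` (`C³ = 0`). [cite: BorelWallach2000, VI Thm 4.11 (2), (3)] -/
theorem finrank_relCohomology_three_eq_zero_four :
    finrank ℂ (relCohomology ℂ gl3 trivialMod.V kSub 3) = 0 ∧ finrank ℂ (relCohomology ℂ gl3 holDS.V kSub 3) = 0 ∧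
      finrank ℂ (relCohomology ℂ gl3 antiholDS.V kSub 3) = 0 ∧ finrank ℂ (relCohomology ℂ gl3 midDS.V kSub 3) = 0 :=
  ⟨trivialMod.finrank_relCohomology_eq_zero 3 relCochain_three_eq_bot_four.1,
    holDS.finrank_relCohomology_eq_zero 3 relCochain_three_eq_bot_four.2.1,
    antiholDS.finrank_relCohomology_eq_zero 3 relCochain_three_eq_bot_four.2.2.1,
    midDS.finrank_relCohomology_eq_zero 3 relCochain_three_eq_bot_four.2.2.2⟩

/-- `H⁴ = 0` for `D₂`, `D₀`, `D₁`, `J_{1,0}`, `J_{0,1}` (`C⁴ = 0`: `V_{1,0}` is not a `K`-type).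
[cite: BorelWallach2000, VI Thm 4.11 (2), (3)] -/
theorem finrank_relCohomology_four_eq_zero_five :
    finrank ℂ (relCohomology ℂ gl3 holDS.V kSub 4) = 0 ∧ finrank ℂ (relCohomology ℂ gl3 antiholDS.V kSub 4) = 0 ∧
      finrank ℂ (relCohomology ℂ gl3 midDS.V kSub 4) = 0 ∧ finrank ℂ (relCohomology ℂ gl3 ladderPlus.V kSub 4) = 0 ∧
        finrank ℂ (relCohomology ℂ gl3 ladderMinus.V kSub 4) = 0 :=
  ⟨holDS.finrank_relCohomology_eq_zero 4 (holDS.relCochain_four_eq_bot six_Ktypes.2.1.1),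
    antiholDS.finrank_relCohomology_eq_zero 4 (antiholDS.relCochain_four_eq_bot six_Ktypes.2.2.1.1),
    midDS.finrank_relCohomology_eq_zero 4 (midDS.relCochain_four_eq_bot six_Ktypes.2.2.2.1.1),
    ladderPlus.finrank_relCohomology_eq_zero 4 (ladderPlus.relCochain_four_eq_bot six_Ktypes.2.2.2.2.1.1),
    ladderMinus.finrank_relCohomology_eq_zero 4 (ladderMinus.relCochain_four_eq_bot six_Ktypes.2.2.2.2.2.1)⟩

/-- **`dim H⁴(𝔤, 𝔨; U(0)) = 1`** (`J_{0,0}`: `H^q = ℂ` for `q = 0, 2, 4`; here `C³ = C⁵ = 0` and `dim C⁴ = 1`, the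
top form `det₄` on `𝔭`). [cite: BorelWallach2000, VI Thm 4.11 (3)] -/
theorem finrank_relCohomology_four_trivialMod : finrank ℂ (relCohomology ℂ gl3 trivialMod.V kSub 4) = 1 := by
  rw [trivialMod.finrank_relCohomology_succ_eq 3 relCochain_three_eq_bot_four.1 trivialMod.relCochain_five_eq_bot,
    finrank_relCochain_four, if_pos six_Ktypes.1.1]

/-- **`H⁵(𝔤, 𝔨; V) = 0`** for every `K`-type datum (`C⁵ = 0`). [cite: BorelWallach2000, VI Thm 4.11 (2), (3)] -/
theorem finrank_relCohomology_five_eq_zero : finrank ℂ (relCohomology ℂ gl3 𝒟.V kSub 5) = 0 :=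
  𝒟.finrank_relCohomology_eq_zero 5 𝒟.relCochain_five_eq_bot

end Six

end SU21Datum

end Literature.RepresentationTheory.Kovacevic2021
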